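import Literature.MathematicalPhysics.QuantumFieldTheory.Balaban1983to89.B9Eq387CubeLocalisedProjection
import Literature.MathematicalPhysics.QuantumFieldTheory.Balaban1983to89.B9Eq387CubeLocalisedProjectionLattice
import Literature.MathematicalPhysics.QuantumFieldTheory.Balaban1983to89.B9Eq3100LeibnizCommutatorDiv
import Literature.MathematicalPhysics.QuantumFieldTheory.Balaban1983to89.B9Thm311SmallFieldCoercivityUniform

/-!
# `Balaban1983to89.B9Eq387CubeFormCoerciveSmallField` — T. Bałaban, *Propagators for lattice gauge theories in a background field*, Commun. Math. Phys.
# **99** (1985) 389–434 [Balaban1985BackgroundPropagators] Thm 3.11 p. 416 with (3.26) p. 395, (3.10) p. 392, (3.8) p. 392, (3.21)–(3.23) p. 394, Cor. 3.6 p. 408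
# and (3.87)–(3.89) p. 409: **S-P6′(γ) AT THE LATTICE ON THE SMALL-BACKGROUND WINDOW — for a background with `ε`-small bond variables EVERY CUBE-LOCALISED
# BOND FORM `‖curl_U z‖² + a‖Q(U)z‖² + ‖R_□(D_U†z)‖²` IS COERCIVE WITH `γ − 3ε_□‖D_U†‖²`, the loss `ε_□` being EXACTLY the (β)-comparison letter
# `‖D†z − R_□(D†z)‖ ≤ ‖D†z − R(U)(D†z)‖ + ε_□‖D†z‖` (the `hcmp` of `B9Eq387CubeLocalisedProjection.cube_form_ge`, inhabited at the lattice by ne9-leaf-05's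
# (K7-D) `B9Eq389CubeLocalisedProjectionAdjoint.norm_sub_projR_collar_le_adjoint`)** — route R2′ STEP B8′ S-P6′(γ), instance-ledger row L10 (loc) of the
# pub-balaban NE9 chain (`t4/ROUTES-NE9.md` v13.45), the (3.35)-class road's small-background INPUT brick

statement-level skeleton of published theorems with citation tags; proofs where landed; nothing here is a claim about the Yang–Mills mass gap

CITATION HEADER (lean-in-tree rule).  Audit cell `pub-balaban`, sub-cell `t4`, BINDER row NE9; filed by NE9 formalisation-swarm LEAF PROVER 06
(`b2b-balaban-t4-ne9-formalise-leaf-06`, gen 72; the S-P6′(α)(β)(γ) lineage — `B9Eq387CubeLocalisedProjection` g64, `…Lattice` g69), as a COMPOSITION BY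
NAME of the cell's own objects: this lineage's abstract (γ) letter `B9Eq387CubeLocalisedProjection.sq_sub_sq_le_of_norm_sub_le` (the exact loss `3ε`) and
`B9Eq387CubeLocalisedProjectionLattice.projR_QprimeL2_eq_RofU` (`R′ = R(U)`), the OWNER lineage's `B9Thm311SmallFieldCoercivityUniform.exists_coercive_
principal_of_small_field_uniform` ([B9] Thm 3.11 second half, `∃ γ ε₀` before the volume), `B5Eq172HodgePositivity.laplaceALatticeK_RLatticeK_eq ∕
re_inner_laplaceAK_projR` ([B5] (1.69)), `B9Eq310HessianOperator.principalOpK_eq_comp ∕ inner_covCoCurlL2K_covCurlL2K` ((3.10)), `B11Eq103H1Complex.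
adjoint_covDerivL2K` ((3.8)), ne9-leaf-04∕-01's `B9Eq3100LeibnizCommutatorDiv.norm_covDivL2K_le_of_transport` (`‖D*A‖ ≤ 2√d‖c‖(1+M_T)‖A‖`).  CONSUMER BY
SHAPE: the (3.35)-class (loc) road (S-P4 local axial gauge `U ↦ Ũ` + locality of `R_□` + (α) `‖R_□w‖ ≤ ‖R(U)w‖` — not typed yet), which needs THIS brick at the
globally small `Ũ`; the `hcmp` socket is (K7-D)'s conclusion VERBATIM (`LinearMap.adjoint D z`, `projR Δs Q″`, `projR Δs Q′`, the letters `hD ∕ hΔs ∕ hQ′`).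
Source READ in the held text [Balaban1985BackgroundPropagators] (journal page = PDF page + 388): p. 416 Thm 3.11; p. 395 (3.26) *«Δ_a(U) = Δ(U) + D_U R(U) D*_U +
Q*(U)aQ(U)»*; p. 408 Cor. 3.6 *«… Theorems 3.1–3.3 hold for the operators G′_□(U), … constructed for the sequence {Ω_j}»*; p. 409 (3.87)–(3.89); p. 392 (3.8),
(3.10); p. 394 (3.21)–(3.23).  [folklore] bookkeeping; NOTHING of print's estimates is asserted or valued.

WHY (row L10, the (3.35)-class content, LOCATED).  For backgrounds in print's class (3.35) (plaquette variables `αη²`-small, bond variables NOT small) the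
local coercivity (loc) on a partition cube is obtained by gauging `U` small on the cube hull (S-P4), extending by `1` to a GLOBALLY small `Ũ`, and using
that the CUBE form — with the cube-localised projection `R_□` in place of `R(U)` — sees only the hull; on `Ũ` one then needs exactly: «the cube form is
coercive».  This file proves that statement from [B9] Thm 3.11's second half (global coercivity of the `R(U)`-form at `Ũ`) and S-P6′(β)(γ): `‖R(U)w‖² −
‖R_□w‖² ≤ 3ε_□‖w‖²` at `w = D_U†z`, `‖D_U†z‖ ≤ M_D‖z‖`.  HONEST LOCATION: the gauge reduction, the locality of `R_□` and the inhabitant of `hcmp` ((K7-D),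
staged by ne9-leaf-05 g77, unfiled) are NOT here; `ε_□` must be made `≤ 1` and small against `γ∕(3M_D²)` by the collar radius and the cube size — the
window's NEEDS-CONSTANT (KAPPA1 ∕ `M₀`), not addressed.

WHAT IS PROVED (sorry-free; proof lane — no `def`, no `Prop` placeholder; [folklore]).
* §1 **`re_inner_laplaceA_principal_eq`** — under `hRS`, ANY averaging `Q`, ANY `a`:
  `re⟪x, laplaceALatticeK η⁻¹ R(U) R(U⁻¹) (principalOpK φ η U) (RofU) Q a x⟫ = ‖curl_U x‖² + ‖R(U)(D*_U x)‖² + a‖Qx‖²` ((3.26) in squares with the principal `Δ(U) = D*D`).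
* §2 **`cube_form_coercive_of_hcmp`** — THE SOCKET: a displayed principal coercivity `hγ : ∀ x, γ‖x‖² ≤ re⟪x, Δ_a^{prin}(U)x⟫` (Thm 3.11's conclusion
  SHAPE, any `Q`, `0 ≤ a`), a divergence bound `hMD : ‖D*_U z‖ ≤ M_D‖z‖`, the letters `hD ∕ hΔs ∕ hQ′` of (K7-D) and its conclusion `hcmp` at the bond field
  `z` for ANY cube constraint `Q″` with `0 ≤ ε ≤ 1` ⟹ `(γ − 3εM_D²)‖z‖² ≤ ‖curl_U z‖² + ‖√a·Qz‖² + ‖projR Δs Q″ (D†z)‖²`.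
* §3 **`exists_cube_form_coercive_small_field`** — §2 ∘ `exists_coercive_principal_of_small_field_uniform` with `M_D := 2√d·‖η⁻¹‖·2` inhabited by
  `norm_covDivL2K_le_of_transport` under the contraction letter for the inverse transports: `∃ γ ε₀ > 0` (functions of `d, L, η, a, c₀, c₁, M_φ, M_φ′` only)
  such that on EVERY lattice, for EVERY background of the host's window (binders VERBATIM) with contractive inverse transports, EVERY cube constraint `Q″`,
  EVERY `0 ≤ ε ≤ 1` and EVERY bond field `z` obeying `hcmp`: `(γ − 3ε(4√d‖η⁻¹‖)²)‖z‖² ≤ ‖curl_U z‖² + ‖√a·Q(U)z‖² + ‖projR Δs Q″ (D_U†z)‖²`.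
HONEST SCOPE.  Small-background window ONLY; the (β) letter `hcmp` and its window ((K7-B)∕(K7-C)∕(K7-D): block decay of `1 − R(U)`, collar radius, Poincaré
constant) are DISPLAYED, not supplied; `γ₁ = 0` currency (mass only); Thm 3.11's two `Q`∕`Q′`-closeness letters `ρ′`, `δ_Q` stay displayed as in the host; NO
number evaluated; ONE averaging step, diagonal `ηL = 1` not even used here.  NOT the (3.35)-class (loc) itself (gauge reduction + locality + (α) — open); NOT
NE9 (cell pub-balaban: NE9 NOT PRINTED ∕ NOT PROVED; «NE9 ⇐ the named binders»; row WALLED ON A MODEL (O-NE9-1; #5 UNRULED); spine PROVED 0∕9; rung (B)+1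
on a finite T⁴ — NOT infinite volume, NOT mass gap, NOT BetaPertH, NOT Clay; HONEST DEPENDENCY: continuum YM on T⁴ ⇐ BetaPertH ∧ nine spine estimates (0/9
proved); BetaPertH ⇐ (D1) ∧ (D4) ∧ CAP+tail; G-an2-4 gates asym, D1 and NE2/3/4).  NEW file; nothing modified.  Net new unproved facts: 0.
-/

noncomputable section

set_option autoImplicit false

open scoped InnerProductSpace ComplexConjugate

namespace Literature.MathematicalPhysics.QuantumFieldTheory.Balaban1983to89.B9Eq387CubeFormCoerciveSmallField

open B4Sect5Torus (TSite)
open B7Prop1Explicit (U1 Wcx boxVec)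
open B9SectCLatticeCarrier (Bond)
open B9Eq311L2Pairing (WL2)
open B9Eq319QprimeTorus (fineP centre weight)
open B9Eq319Onto (centreFun)
open B11Eq103H1Complex (SiteL2K BondL2K covDerivL2K covDivL2K covLaplaceSiteK laplaceALatticeK RLatticeK projR adjoint_covDerivL2K)
open B9Eq310HessianOperator (adTransportW principalOpK principalOpK_eq_comp covCurlL2K inner_covCoCurlL2K_covCurlL2K)
open B9Eq326OperatorAssembly (RofU QprimeW)
open B9Eq315QTorus (perCfg cornerSite QtorusW)
open B5Eq172FlatCoercivity (hU1_one hreg_one)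
open B5Eq172HodgePositivity (laplaceALatticeK_RLatticeK_eq re_inner_laplaceAK_projR conj_inv_ofReal)
open B9Thm311SmallFieldCoercivityUniform (exists_coercive_principal_of_small_field_uniform)
open B9Eq387CubeLocalisedProjection (sq_sub_sq_le_of_norm_sub_le hasOrthogonalProjection_of_finiteDimensional)
open B9Eq387CubeLocalisedProjectionLattice (projR_QprimeL2_eq_RofU)
open B9Eq3100LeibnizCommutatorDiv (norm_covDivL2K_le_of_transport)

/-! ## §1 The form identity `re⟪x, Δ_a^{prin}(U)x⟫ = ‖curl_U x‖² + ‖R(U)D*_U x‖² + a‖Qx‖²` -/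

section Form

variable {d : ℕ} (L : ℕ) [NeZero L] (m : Fin d → ℕ)
  {𝔸 : Type*} [NormedRing 𝔸] [NormedAlgebra ℂ 𝔸]
  {W : Type*} [NormedAddCommGroup W] [InnerProductSpace ℂ W] [FiniteDimensional ℂ W] (φ : W ≃ₗ[ℂ] 𝔸)
  (c₀ : ℝ) [Fact (0 < c₀)] (η : ℝ) (U : Bond d (fineP L m) → 𝔸ˣ)
  (hRS : ∀ (b : Bond d (fineP L m)) (v u : W), ⟪adTransportW φ U b v, u⟫_ℂ = ⟪v, adTransportW φ (fun b => (U b)⁻¹) b u⟫_ℂ)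
  {F : Type*} [NormedAddCommGroup F] [InnerProductSpace ℂ F] [FiniteDimensional ℂ F]

include hRS in
/-- **(3.26) WITH THE PRINCIPAL `Δ(U) = D*D`, IN SQUARES**: for mutually adjoint transporters, ANY averaging `Q` and ANY `a`,
`re⟪x, (D*D + D R(U) D* + aQ†Q)x⟫ = ‖curl_U x‖² + ‖R(U)(D*_U x)‖² + a‖Qx‖²` — `laplaceALatticeK_RLatticeK_eq` + [B5] (1.69) `re_inner_laplaceAK_projR`
+ (3.10) `re⟪x, D*Dx⟫ = ‖curl x‖²` + (3.8) `D† = D*`. [folklore] [cite: Balaban1985BackgroundPropagators, (3.26) p.395, (3.10) p.392, (3.8) p.392, (3.21)–(3.23) p.394; Balaban1984PropagatorsI, (1.69) p.29] -/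
theorem re_inner_laplaceA_principal_eq (Q : BondL2K ℂ d (fineP L m) c₀ W →ₗ[ℂ] F) (a : ℝ) (x : BondL2K ℂ d (fineP L m) c₀ W) :
    RCLike.re ⟪x, laplaceALatticeK ((η : ℂ))⁻¹ (adTransportW φ U) (adTransportW φ fun b => (U b)⁻¹) (principalOpK φ η U)
        (RofU L m φ η U (c₀ := c₀)) Q a x⟫_ℂ =
      ‖covCurlL2K ℂ c₀ ((η : ℂ))⁻¹ (adTransportW φ U) x‖ ^ 2 +
        ‖RofU L m φ η U (c₀ := c₀) (covDivL2K ℂ c₀ ((η : ℂ))⁻¹ (adTransportW φ fun b => (U b)⁻¹) x)‖ ^ 2 + a * ‖Q x‖ ^ 2 := by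
  have hc : conj (((η : ℂ))⁻¹) = ((η : ℂ))⁻¹ := conj_inv_ofReal η
  have h1 : RCLike.re ⟪x, principalOpK (c₀ := c₀) φ η U x⟫_ℂ = ‖covCurlL2K ℂ c₀ ((η : ℂ))⁻¹ (adTransportW φ U) x‖ ^ 2 := by
    rw [principalOpK_eq_comp, LinearMap.comp_apply, inner_covCoCurlL2K_covCurlL2K _ hc _ _ hRS, ← RCLike.ofReal_pow, RCLike.ofReal_re]
  have hR : RofU L m φ η U (c₀ := c₀) =
      RLatticeK ((η : ℂ))⁻¹ (adTransportW φ U) (adTransportW φ fun b => (U b)⁻¹) (QprimeW L m φ U (c₀ := c₀)) := rfl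
  rw [hR, laplaceALatticeK_RLatticeK_eq _ hc _ _ hRS, re_inner_laplaceAK_projR, h1, adjoint_covDerivL2K _ hc _ _ hRS]
  rfl

end Form

/-! ## §2 The socket: cube-form coercivity from a displayed principal coercivity and the (β) comparison -/

section Socket

/-- `‖(√a : ℂ) • y‖² = a‖y‖²` for `0 ≤ a`. [folklore] -/
private theorem norm_sq_sqrt_smul {F : Type*} [SeminormedAddCommGroup F] [NormedSpace ℂ F] {a : ℝ} (ha : 0 ≤ a) (y : F) :
    ‖((Real.sqrt a : ℝ) : ℂ) • y‖ ^ 2 = a * ‖y‖ ^ 2 := by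
  rw [norm_smul, mul_pow, Complex.norm_real, Real.norm_eq_abs, abs_of_nonneg (Real.sqrt_nonneg _), Real.sq_sqrt ha]

variable {d : ℕ} (L : ℕ) [NeZero L] (m : Fin d → ℕ)
  {𝔸 : Type*} [NormedRing 𝔸] [NormedAlgebra ℂ 𝔸]
  {W : Type*} [NormedAddCommGroup W] [InnerProductSpace ℂ W] [FiniteDimensional ℂ W] (φ : W ≃ₗ[ℂ] 𝔸)
  (c₀ : ℝ) [Fact (0 < c₀)] {c₁ : ℝ} (η : ℝ) (U : Bond d (fineP L m) → 𝔸ˣ)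
  (hRS : ∀ (b : Bond d (fineP L m)) (v u : W), ⟪adTransportW φ U b v, u⟫_ℂ = ⟪v, adTransportW φ (fun b => (U b)⁻¹) b u⟫_ℂ)
  {F : Type*} [NormedAddCommGroup F] [InnerProductSpace ℂ F] [FiniteDimensional ℂ F]
  {F'' : Type*} [AddCommGroup F''] [Module ℂ F'']

include hRS in
/-- **S-P6′(γ) AT THE LATTICE — THE SOCKET.**  If the `R(U)`-form is coercive, `γ‖x‖² ≤ re⟪x, (D*D + D R(U) D* + aQ†Q)x⟫` for every `x` (the displayed
`hγ` = the conclusion SHAPE of [B9] Thm 3.11's second half in the tree, any `Q`, `0 ≤ a`), if `‖D*_U z‖ ≤ M_D‖z‖`, and if the cube projection `R_□ =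
projR Δs Q″` obeys the (β) comparison at `w = D_U†z` with `0 ≤ ε ≤ 1` — the `hcmp` binder, in (K7-D) `norm_sub_projR_collar_le_adjoint`'s letters
`D = D_U`, `Δs = Δ^η_U`, `Q′ = (L²)⁻¹ ∘ Q′(U)` — then the CUBE form is coercive with the loss `3εM_D²`:
`(γ − 3εM_D²)‖z‖² ≤ ‖curl_U z‖² + ‖√a·Qz‖² + ‖R_□(D_U†z)‖²`.  §1 + `R′ = R(U)` + the exact loss `‖R′w‖² − ‖R″w‖² ≤ 3ε‖w‖²`; one `nlinarith`.
[folklore] [cite: Balaban1985BackgroundPropagators, Thm 3.11 p.416, (3.26) p.395, Cor 3.6 p.408, (3.87)–(3.89) p.409, (3.8) p.392] -/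
theorem cube_form_coercive_of_hcmp (Q : BondL2K ℂ d (fineP L m) c₀ W →ₗ[ℂ] F) {a γ : ℝ} (ha : 0 ≤ a)
    (hγ : ∀ x : BondL2K ℂ d (fineP L m) c₀ W, γ * ‖x‖ ^ 2 ≤
      RCLike.re ⟪x, laplaceALatticeK ((η : ℂ))⁻¹ (adTransportW φ U) (adTransportW φ fun b => (U b)⁻¹) (principalOpK φ η U)
        (RofU L m φ η U (c₀ := c₀)) Q a x⟫_ℂ)
    {MD : ℝ} (hMD : ∀ z : BondL2K ℂ d (fineP L m) c₀ W, ‖covDivL2K ℂ c₀ ((η : ℂ))⁻¹ (adTransportW φ fun b => (U b)⁻¹) z‖ ≤ MD * ‖z‖)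
    (D : SiteL2K ℂ d (fineP L m) c₀ W →ₗ[ℂ] BondL2K ℂ d (fineP L m) c₀ W) (hD : D = covDerivL2K ℂ c₀ ((η : ℂ))⁻¹ (adTransportW φ U))
    (Δs : SiteL2K ℂ d (fineP L m) c₀ W →ₗ[ℂ] SiteL2K ℂ d (fineP L m) c₀ W)
    (hΔs : Δs = covLaplaceSiteK ((η : ℂ))⁻¹ (adTransportW φ U) (adTransportW φ fun b => (U b)⁻¹))
    (Q' : SiteL2K ℂ d (fineP L m) c₀ W →ₗ[ℂ] SiteL2K ℂ d m c₁ W)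
    (hQ' : Q' = (WL2.linearEquiv ℂ ℂ (fun _ : TSite d m => c₁)).symm.toLinearMap ∘ₗ QprimeW L m φ U (c₀ := c₀))
    (Q'' : SiteL2K ℂ d (fineP L m) c₀ W →ₗ[ℂ] F'') {ε : ℝ} (hε0 : 0 ≤ ε) (hε1 : ε ≤ 1) (z : BondL2K ℂ d (fineP L m) c₀ W)
    (hcmp : ‖LinearMap.adjoint D z - projR Δs Q'' (LinearMap.adjoint D z)‖ ≤
      ‖LinearMap.adjoint D z - projR Δs Q' (LinearMap.adjoint D z)‖ + ε * ‖LinearMap.adjoint D z‖) :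
    (γ - 3 * ε * MD ^ 2) * ‖z‖ ^ 2 ≤
      ‖covCurlL2K ℂ c₀ ((η : ℂ))⁻¹ (adTransportW φ U) z‖ ^ 2 + ‖((Real.sqrt a : ℝ) : ℂ) • Q z‖ ^ 2 +
        ‖projR Δs Q'' (LinearMap.adjoint D z)‖ ^ 2 := by
  have hc : conj (((η : ℂ))⁻¹) = ((η : ℂ))⁻¹ := conj_inv_ofReal η
  haveI := hasOrthogonalProjection_of_finiteDimensional (𝕜 := ℂ) ((LinearMap.ker Q').map Δs)
  haveI := hasOrthogonalProjection_of_finiteDimensional (𝕜 := ℂ) ((LinearMap.ker Q'').map Δs)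
  -- the exact loss of S-P6′(γ)
  have h3 : ‖projR Δs Q' (LinearMap.adjoint D z)‖ ^ 2 - ‖projR Δs Q'' (LinearMap.adjoint D z)‖ ^ 2 ≤
      3 * ε * ‖LinearMap.adjoint D z‖ ^ 2 :=
    sq_sub_sq_le_of_norm_sub_le (U := (LinearMap.ker Q'').map Δs) (V := (LinearMap.ker Q').map Δs) hε0 hε1 (LinearMap.adjoint D z) hcmp
  -- `D† = D*_U` and `R′ = R(U)` at the letters
  have hadj : LinearMap.adjoint D z = covDivL2K ℂ c₀ ((η : ℂ))⁻¹ (adTransportW φ fun b => (U b)⁻¹) z := by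
    rw [hD, adjoint_covDerivL2K _ hc _ _ hRS]
  have hRR : projR Δs Q' = RofU L m φ η U (c₀ := c₀) := by
    rw [hΔs, hQ']; exact projR_QprimeL2_eq_RofU L m φ (c₁ := c₁) η U
  rw [hRR, hadj] at h3
  -- Thm 3.11's conclusion in squares
  have hSC := hγ z
  rw [re_inner_laplaceA_principal_eq L m φ c₀ η U hRS Q a z] at hSC
  -- the divergence bound, squared
  have hDz := hMD z
  have hsq : ‖covDivL2K ℂ c₀ ((η : ℂ))⁻¹ (adTransportW φ fun b => (U b)⁻¹) z‖ ^ 2 ≤ MD ^ 2 * ‖z‖ ^ 2 := by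
    rw [← mul_pow]; exact pow_le_pow_left₀ (norm_nonneg _) hDz 2
  have hprod : 3 * ε * ‖covDivL2K ℂ c₀ ((η : ℂ))⁻¹ (adTransportW φ fun b => (U b)⁻¹) z‖ ^ 2 ≤ 3 * ε * (MD ^ 2 * ‖z‖ ^ 2) :=
    mul_le_mul_of_nonneg_left hsq (by positivity)
  rw [norm_sq_sqrt_smul ha, hadj]
  nlinarith [h3, hSC, hprod]

end Socket

/-! ## §3 On the small-background window: `∃ γ ε₀` before the volume, `M_D` inhabited -/

section SmallField

variable {d : ℕ} (L : ℕ) [NeZero L] (hL : 1 ≤ L)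
  {𝔸 : Type*} [NormedRing 𝔸] [NormedAlgebra ℂ 𝔸] [CompleteSpace 𝔸] [NormOneClass 𝔸]
  {W : Type*} [NormedAddCommGroup W] [InnerProductSpace ℂ W] [FiniteDimensional ℂ W] (φ : W ≃ₗ[ℂ] 𝔸) {c₀ c₁ : ℝ} [Fact (0 < c₀)] [Fact (0 < c₁)]
  {F'' : Type*} [AddCommGroup F''] [Module ℂ F'']

/-- **S-P6′(γ) ON THE SMALL-BACKGROUND WINDOW — EVERY CUBE FORM COERCIVE WITH `γ − 3ε_□(4√d‖η⁻¹‖)²`.**  [B9] Thm 3.11's second half with `γ, ε₀` before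
the volume (`exists_coercive_principal_of_small_field_uniform`, binders VERBATIM) composed with §2, the divergence bound INHABITED as `M_D := 2√d·‖η⁻¹‖·2`
by `norm_covDivL2K_le_of_transport` under the contraction letter for the inverse transports: `∃ γ ε₀ > 0` such that on EVERY lattice `TSite d (L·m)`, for
EVERY background `U` of the window (unit-bounded `ε′`-small bond variables, `hRS`, contractive `R(U(b)⁻¹)`, `Q(U)`'s data, the centre-lift
`Q′`-closeness `ρ′`, the `Q`-closeness `δ_Q`, `ε′ + ρ′ + δ_Q ≤ ε₀`), the letters `D = D_U`, `Δs = Δ^η_U`, `Q′ = (L²)⁻¹∘Q′(U)`, EVERY cube constraint `Q″`,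
EVERY `0 ≤ ε ≤ 1` and EVERY bond field `z` obeying the (β) comparison `hcmp`:
`(γ − 3ε(2√d·‖η⁻¹‖·2)²)‖z‖² ≤ ‖curl_U z‖² + ‖√a·Q(U)z‖² + ‖projR Δs Q″ (D_U†z)‖²`.
[cite: Balaban1985BackgroundPropagators, Thm 3.11 p.416, (3.82)–(3.86) p.407, (3.26) p.395, Cor 3.6 p.408, (3.87)–(3.89) p.409, (3.8) p.392; Balaban1984PropagatorsI, Prop. 1.1 (1.90) p.33] -/
theorem exists_cube_form_coercive_small_field {η : ℝ} (hη : η ≠ 0) {a : ℝ} (ha : 0 < a) {Mφ Mφ' : ℝ} (hMφ : 0 ≤ Mφ)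
    (hMφ' : 0 ≤ Mφ') (hφ : ∀ w, ‖φ w‖ ≤ Mφ * ‖w‖) (hφ' : ∀ X, ‖φ.symm X‖ ≤ Mφ' * ‖X‖) :
    ∃ γ ε₀ : ℝ, 0 < γ ∧ 0 < ε₀ ∧ ∀ (m : Fin d → ℕ) [∀ i, NeZero (fineP L m i)]
      (U : Bond d (fineP L m) → 𝔸ˣ) {α : ℝ} (hα1 : α ≤ 1 / 64)
      (hU1 : ∀ (x : B7Prop1Explicit.Site d) (κ : Fin d), perCfg (fineP L m) U x κ ∈ U1 𝔸)
      (hreg : ∀ (y : TSite d m) (κ : Fin d) (r : Fin d → Fin L), ‖((Wcx L (perCfg (fineP L m) U) (cornerSite L y) κ (boxVec L r) : 𝔸ˣ) : 𝔸) - 1‖ ≤ α)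
      {ε' ρ' δQ : ℝ}, 0 ≤ ε' → 0 ≤ ρ' → 0 ≤ δQ → ε' + ρ' + δQ ≤ ε₀ →
      (∀ b, U b ∈ U1 𝔸) → (∀ b, ‖(U b : 𝔸) - 1‖ ≤ ε') →
      (∀ (b : Bond d (fineP L m)) (v u : W), ⟪adTransportW φ U b v, u⟫_ℂ = ⟪v, adTransportW φ (fun b => (U b)⁻¹) b u⟫_ℂ) →
      (∀ (b : Bond d (fineP L m)) (v : W), ‖adTransportW φ (fun b => (U b)⁻¹) b v‖ ≤ ‖v‖) →
      (∀ l : SiteL2K ℂ d (fineP L m) c₀ W,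
        ‖(WL2.equiv ℂ (fun _ : TSite d (fineP L m) => c₀) W).symm (centreFun (weight L m) (centre L m)
          (QprimeW L m φ U l - QprimeW L m φ (fun _ : Bond d (fineP L m) => (1 : 𝔸ˣ)) l))‖ ≤ ρ' * ‖l‖) →
      (∀ x : BondL2K ℂ d (fineP L m) c₀ W, ‖QtorusW L m hL φ U hα1 hU1 hreg (c₁ := c₁) x -
        QtorusW L m hL φ (fun _ => 1) (show (0 : ℝ) ≤ 1 / 64 by norm_num) (hU1_one L m) (hreg_one L m) (c₁ := c₁) x‖ ≤ δQ * ‖x‖) →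
      ∀ (D : SiteL2K ℂ d (fineP L m) c₀ W →ₗ[ℂ] BondL2K ℂ d (fineP L m) c₀ W),
        D = covDerivL2K ℂ c₀ ((η : ℂ))⁻¹ (adTransportW φ U) →
      ∀ (Δs : SiteL2K ℂ d (fineP L m) c₀ W →ₗ[ℂ] SiteL2K ℂ d (fineP L m) c₀ W),
        Δs = covLaplaceSiteK ((η : ℂ))⁻¹ (adTransportW φ U) (adTransportW φ fun b => (U b)⁻¹) →
      ∀ (Q' : SiteL2K ℂ d (fineP L m) c₀ W →ₗ[ℂ] SiteL2K ℂ d m c₁ W),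
        Q' = (WL2.linearEquiv ℂ ℂ (fun _ : TSite d m => c₁)).symm.toLinearMap ∘ₗ QprimeW L m φ U (c₀ := c₀) →
      ∀ (Q'' : SiteL2K ℂ d (fineP L m) c₀ W →ₗ[ℂ] F'') {ε : ℝ}, 0 ≤ ε → ε ≤ 1 →
      ∀ z : BondL2K ℂ d (fineP L m) c₀ W,
        ‖LinearMap.adjoint D z - projR Δs Q'' (LinearMap.adjoint D z)‖ ≤
          ‖LinearMap.adjoint D z - projR Δs Q' (LinearMap.adjoint D z)‖ + ε * ‖LinearMap.adjoint D z‖ →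
        (γ - 3 * ε * (2 * Real.sqrt d * (‖((η : ℂ))⁻¹‖ * (1 + 1))) ^ 2) * ‖z‖ ^ 2 ≤
          ‖covCurlL2K ℂ c₀ ((η : ℂ))⁻¹ (adTransportW φ U) z‖ ^ 2 +
            ‖((Real.sqrt a : ℝ) : ℂ) • QtorusW L m hL φ U hα1 hU1 hreg (c₁ := c₁) z‖ ^ 2 + ‖projR Δs Q'' (LinearMap.adjoint D z)‖ ^ 2 := by
  obtain ⟨γ, ε₀, hγ, hε₀, H⟩ :=
    exists_coercive_principal_of_small_field_uniform L hL φ (c₀ := c₀) (c₁ := c₁) hη ha hMφ hMφ' hφ hφ'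
  refine ⟨γ, ε₀, hγ, hε₀, ?_⟩
  intro m _ U α hα1 hU1 hreg ε' ρ' δQ hε' hρ' hδQ ht hUb hUε hRS hS hQ' hQ D hD Δs hΔs Q' hQ'' Q'' ε hε0 hε1 z hcmp
  have hMD : ∀ z : BondL2K ℂ d (fineP L m) c₀ W,
      ‖covDivL2K ℂ c₀ ((η : ℂ))⁻¹ (adTransportW φ fun b => (U b)⁻¹) z‖ ≤ 2 * Real.sqrt d * (‖((η : ℂ))⁻¹‖ * (1 + 1)) * ‖z‖ :=
    fun z => norm_covDivL2K_le_of_transport (S := adTransportW φ fun b => (U b)⁻¹) zero_le_one (fun b v => by rw [one_mul]; exact hS b v) _ z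
  exact cube_form_coercive_of_hcmp L m φ c₀ η U hRS _ ha.le
    (H m U hα1 hU1 hreg hε' hρ' hδQ ht hUb hUε hRS hQ' hQ) hMD D hD Δs hΔs Q' hQ'' Q'' hε0 hε1 z hcmp

end SmallField

end Literature.MathematicalPhysics.QuantumFieldTheory.Balaban1983to89.B9Eq387CubeFormCoerciveSmallField

end
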